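import Literature.NumberTheory.EllipticCurves.GreenbergVatsal2000.CharacterLValueCEulerFactorProofs
import Literature.NumberTheory.EllipticCurves.GreenbergVatsal2000.CharacterPAdicLFunctionCProofs
import Literature.NumberTheory.EllipticCurves.GreenbergVatsal2000.CharacterPAdicLFunctionExistenceProofs
import HarnessLib

/-!
# The interpolation predicates `IsCharacterLFunctionC/D` do not depend on the PRESENTATION of the
# character (route K1 `AdditiveBranchIMC`, crux ReadingFacts, child 19297 `GreenbergVatsalResidualBranch`
# — supports only; seat `bsd-inputs-abimc-rf-p1`)

HONEST FRAMING (cell `bsd-addord`, `run/shared/lean/pub/bsd-addord/README.md` §4): THEOREMS ONLY (no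
`def`, no named fact, no `sorry`); nothing is booked; BSD is not proved by any of this. This file is a
TOOL for the kernel derivation of the reading fact
`GreenbergVatsal2000.thm312_branch_unitContent_and_lambda_eq_residual_goodOrd` (item 19297) from the
tree's verbatim-er Greenberg–Vatsal statements (`…GreenbergVatsalResidualBranchOfPrint.lean`).

## What and why

The tree's predicates `IsCharacterLFunctionC p φ Σ₀ g` / `IsCharacterLFunctionD p ψ Σ₀ g`
(`CharacterPAdicLFunctions.lean`: "`g` interpolates `−(1/k)·B_{k,φω^{−k}·1_{Σ₀∪{p}}}`", resp. the
`D`-values) take a Dirichlet character `φ` PRESENTED modulo some `m`. The same Galois character has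
many presentations (`φ` mod `m`, `changeLevel φ` mod `m'`, its primitive character mod `cond φ`, a
product `χ·φ` mod `p·m` whose conductor is smaller, …); Greenberg–Vatsal's twisted Eisenstein
congruence `thm311_quadraticTwist_…` (Thm. (3.11) at `χ = (·/p)`) presents the residual characters
of the twist as PRODUCTS `(·/p)·φ` mod `p·m`, while the character facts
`characterLFunctionC/D_hasUnitContent_and_order_eq_card_of_…` want PRIMITIVE characters. This file
proves the (elementary) bridge: the interpolated values, hence the predicates, agree for two
presentations that agree as functions on the integers prime to `p` (and, for `C`, prime to `Σ₀`):

* `characterLValueC_eq_of_apply_eq`, `isCharacterLFunctionC_iff_of_apply_eq` — if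
  `φ₁(a) = φ₂(a)` for every `a` prime to `p` and to every `ℓ ∈ Σ₀`, then
  `characterLValueC p φ₁ Σ₀ k = characterLValueC p φ₂ Σ₀ k` (`k ≥ 1`): the depleted twisted functions
  `φ_iω^{−k}·1_{Σ₀∪{p}}` coincide, and the generalized Bernoulli number does not depend on the period
  used to compute it (Lang Ch. 2 §2 **B 4**/**B 7**, tree `twistedBernoulli_mul_eq`);
* `characterLValueD_eq_of_apply_eq`, `isCharacterLFunctionD_iff_of_apply_eq` — the same for `D`, under
  `ψ₁(a) = ψ₂(a)` for every `a` prime to `p` (the `D`-value carries the undepleted Bernoulli number of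
  `(ωψ⁻¹)ω^{−k}·1_{p∤·}` and the explicit `Σ₀`-Euler factors `1 − ψ(ℓ)ω(ℓ)^{k−1}ℓ^{−k}`, `ℓ ≠ p`).

References: [LangCyclotomic1990] Ch. 2 §2 (B 4, B 7); [GreenbergVatsal2000] §3 pp. 41–42 ((26), (27),
`Σ₀`-depletion); [Washington1997] Ch. 3 (conductors).
-/

set_option autoImplicit false
set_option linter.dupNamespace false

noncomputable section

open scoped Classical

namespace Summit.BirchSwinnertonDyer.BirchSwinnertonDyer.Theorems.AdditiveBranchIMCCharacterLFunctionPresentation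

open NumberField IsDedekindDomain Literature.NumberTheory.EllipticCurves
  Literature.NumberTheory.EllipticCurves.GreenbergVatsal2000

variable (p : ℕ) [hp : Fact p.Prime] (S₀ : Finset (HeightOneSpectrum (𝓞 ℚ)))

/-! ### §0 The generalized Bernoulli number of a function with two periods -/

/-- **Lang B 7 with B 4, two periods**: if `θ` is periodic modulo `N₁` and modulo `N₂` (both `≥ 1`),
the generalized Bernoulli number `B_{k,θ}` (`k ≥ 1`) computed with period `N₁` equals the one computed
with period `N₂` (both equal the one with period `N₁N₂`). [cite: LangCyclotomic1990, Ch. 2 §2, B 4 and B 7 (PDF pp. 34–35)] -/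
theorem twistedBernoulli_eq_of_periodic {k : ℕ} (hk : 1 ≤ k) {N₁ N₂ : ℕ} (hN₁ : 0 < N₁)
    (hN₂ : 0 < N₂) (θ : ℕ → ℤ_[p]) (h₁ : ∀ a, θ (a + N₁) = θ a) (h₂ : ∀ a, θ (a + N₂) = θ a) :
    twistedBernoulli p k N₁ θ = twistedBernoulli p k N₂ θ := by
  rw [← twistedBernoulli_mul_eq p hk hN₁ hN₂ θ h₁, ← twistedBernoulli_mul_eq p hk hN₂ hN₁ θ h₂,
    mul_comm]

/-! ### §1 `C`: presentations agreeing off `p` and `Σ₀` -/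

section C

variable {m₁ m₂ : ℕ} (φ₁ : DirichletCharacter (ZMod p) m₁) (φ₂ : DirichletCharacter (ZMod p) m₂)

/-- Two presentations agreeing on the integers prime to `p` and to `Σ₀` have the same depleted twisted
function `φω^{−k}·1_{Σ₀∪{p}}` (Lang Ch. 2 §2: characters "extended by `0`").
[cite: LangCyclotomic1990, Ch. 2 §2, B 6–B 7 (PDF p. 35)] -/
theorem depletedEvenCharacterTwist_eq_of_apply_eq
    (hφ : ∀ a : ℕ, ¬ p ∣ a → (¬ ∃ v ∈ S₀, Rat.HeightOneSpectrum.natGenerator v ∣ a) →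
      φ₁ (a : ZMod m₁) = φ₂ (a : ZMod m₂)) (k : ℕ) :
    depletedEvenCharacterTwist p φ₁ S₀ k = depletedEvenCharacterTwist p φ₂ S₀ k := by
  funext a
  unfold depletedEvenCharacterTwist evenCharacterTwist
  by_cases hS : ∃ v ∈ S₀, Rat.HeightOneSpectrum.natGenerator v ∣ a
  · simp only [hS, if_true]
  · simp only [hS, if_false]
    by_cases hpa : p ∣ a
    · simp only [hpa, if_true]
    · simp only [hpa, if_false, hφ a hpa hS]

/-- **The interpolated `C`-values do not depend on the presentation**: under the agreement
hypothesis, `characterLValueC p φ₁ Σ₀ k = characterLValueC p φ₂ Σ₀ k` for every `k ≥ 1`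
(same depleted function; Bernoulli number independent of the period, Lang B 4/B 7).
[cite: LangCyclotomic1990, Ch. 2 §2, B 4 and B 7 (PDF pp. 34–35)] -/
theorem characterLValueC_eq_of_apply_eq (hm₁ : 0 < m₁) (hm₂ : 0 < m₂)
    (hφ : ∀ a : ℕ, ¬ p ∣ a → (¬ ∃ v ∈ S₀, Rat.HeightOneSpectrum.natGenerator v ∣ a) →
      φ₁ (a : ZMod m₁) = φ₂ (a : ZMod m₂)) {k : ℕ} (hk : 1 ≤ k) :
    characterLValueC p φ₁ S₀ k = characterLValueC p φ₂ S₀ k := by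
  have hfun := depletedEvenCharacterTwist_eq_of_apply_eq p S₀ φ₁ φ₂ hφ k
  unfold characterLValueC
  rw [hfun]
  congr 1
  exact twistedBernoulli_eq_of_periodic p hk (depletedModulus_pos p S₀ hm₁)
    (depletedModulus_pos p S₀ hm₂) _
    (fun a ↦ by rw [← hfun]; exact depletedEvenCharacterTwist_add_depletedModulus p φ₁ S₀ k a)
    (depletedEvenCharacterTwist_add_depletedModulus p φ₂ S₀ k)

/-- **`IsCharacterLFunctionC` does not depend on the presentation of the character** (agreement off
`p` and `Σ₀`). [cite: GreenbergVatsal2000, §3 pp. 41–42 (L_{Σ₀}(C,χ,T) characterized by interpolation)] -/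
theorem isCharacterLFunctionC_iff_of_apply_eq (hm₁ : 0 < m₁) (hm₂ : 0 < m₂)
    (hφ : ∀ a : ℕ, ¬ p ∣ a → (¬ ∃ v ∈ S₀, Rat.HeightOneSpectrum.natGenerator v ∣ a) →
      φ₁ (a : ZMod m₁) = φ₂ (a : ZMod m₂)) (g : IwasawaAlgebra p) :
    IsCharacterLFunctionC p φ₁ S₀ g ↔ IsCharacterLFunctionC p φ₂ S₀ g := by
  unfold IsCharacterLFunctionC
  refine forall_congr' fun k ↦ forall_congr' fun hk ↦ ?_
  rw [characterLValueC_eq_of_apply_eq p S₀ φ₁ φ₂ hm₁ hm₂ hφ hk]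

end C

/-! ### §2 `D`: presentations agreeing off `p` -/

section D

variable {d₁ d₂ : ℕ} (ψ₁ : DirichletCharacter (ZMod p) d₁) (ψ₂ : DirichletCharacter (ZMod p) d₂)

/-- Two presentations agreeing on the integers prime to `p` have the same twisted function
`(ωψ⁻¹)ω^{−k}·1_{p∤·}`. [cite: LangCyclotomic1990, Ch. 2 §2, B 6–B 7 (PDF p. 35)] -/
theorem oddCharacterTwist_eq_of_apply_eq
    (hψ : ∀ a : ℕ, ¬ p ∣ a → ψ₁ (a : ZMod d₁) = ψ₂ (a : ZMod d₂)) (k : ℕ) :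
    oddCharacterTwist p ψ₁ k = oddCharacterTwist p ψ₂ k := by
  funext a
  unfold oddCharacterTwist
  by_cases hpa : p ∣ a
  · simp only [hpa, if_true]
  · simp only [hpa, if_false, hψ a hpa]

/-- **The interpolated `D`-values do not depend on the presentation**: under the agreement hypothesis
(and `p ∉ Σ₀`), `characterLValueD p ψ₁ Σ₀ k = characterLValueD p ψ₂ Σ₀ k` for every `k ≥ 1`
(same twisted function, Bernoulli number independent of the period, same `Σ₀`-Euler factors).
[cite: LangCyclotomic1990, Ch. 2 §2, B 4 and B 7 (PDF pp. 34–35)] -/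
theorem characterLValueD_eq_of_apply_eq (hd₁ : 0 < d₁) (hd₂ : 0 < d₂)
    (hS₀ : ∀ v ∈ S₀, ¬ p ∣ Rat.HeightOneSpectrum.natGenerator v)
    (hψ : ∀ a : ℕ, ¬ p ∣ a → ψ₁ (a : ZMod d₁) = ψ₂ (a : ZMod d₂)) {k : ℕ} (hk : 1 ≤ k) :
    characterLValueD p ψ₁ S₀ k = characterLValueD p ψ₂ S₀ k := by
  have hfun := oddCharacterTwist_eq_of_apply_eq p ψ₁ ψ₂ hψ k
  have hpp : 0 < p := hp.out.pos
  unfold characterLValueD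
  congr 1
  · rw [hfun]
    congr 2
    exact twistedBernoulli_eq_of_periodic p hk (Nat.mul_pos hd₁ hpp) (Nat.mul_pos hd₂ hpp) _
      (fun a ↦ by rw [← hfun]; exact oddCharacterTwist_add_mul p ψ₁ k a)
      (oddCharacterTwist_add_mul p ψ₂ k)
  · refine Finset.prod_congr rfl fun v hv ↦ ?_
    rw [hψ _ (hS₀ v hv)]

/-- **`IsCharacterLFunctionD` does not depend on the presentation of the character** (agreement off
`p`; `p ∉ Σ₀`). [cite: GreenbergVatsal2000, §3 p. 42 (L_{Σ₀}(D,χ,T) characterized by interpolation)] -/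
theorem isCharacterLFunctionD_iff_of_apply_eq (hd₁ : 0 < d₁) (hd₂ : 0 < d₂)
    (hS₀ : ∀ v ∈ S₀, ¬ p ∣ Rat.HeightOneSpectrum.natGenerator v)
    (hψ : ∀ a : ℕ, ¬ p ∣ a → ψ₁ (a : ZMod d₁) = ψ₂ (a : ZMod d₂)) (g : IwasawaAlgebra p) :
    IsCharacterLFunctionD p ψ₁ S₀ g ↔ IsCharacterLFunctionD p ψ₂ S₀ g := by
  unfold IsCharacterLFunctionD
  refine forall_congr' fun k ↦ forall_congr' fun hk ↦ ?_
  rw [characterLValueD_eq_of_apply_eq p S₀ ψ₁ ψ₂ hd₁ hd₂ hS₀ hψ hk]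

end D

end Summit.BirchSwinnertonDyer.BirchSwinnertonDyer.Theorems.AdditiveBranchIMCCharacterLFunctionPresentation

end
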